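import Literature.NumberTheory.ConnesMoscovici2022.UVProlateInhomogeneousToolkit
import Literature.NumberTheory.ConnesMoscovici2022.UVProlateDeficiencyODE
import HarnessLib

/-!
# Connes–Moscovici 2022, §1: the variation-of-parameters formula for `(W − z) h = f` on a component

LINE 1 — FRAMING. RH-FREE corpus literature (spectral theory of the prolate wave operator
`W_λ = −∂(λ² − x²)∂ + (2πλx)²` on `L²(ℝ)`; sequel row O2 of the Connes–Consani corpus, no leaf / binder
role).  bears_on: LADDER-RH W-C/W-P.  WHAT THIS IS NOT: any claim about RH; nothing in this file
mentions `RiemannHypothesis` or bears on the truth of RH.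

Theorems-only step of the COMPACT-RESOLVENT clause of [ConnesMoscovici2022, Thm 1.6 (iv)]
(= arXiv:2112.05500 Thm 2.6 (iv)) by the route "Hilbert–Schmidt right inverse of `W_max − z` + finite
deficiency" (`Literature.Analysis.UnboundedOperators.isCompactOperator_resolvent_of_rightInverse`).
On an interval `J ⊆ ℝ ∖ {±λ}` carrying two classical solution pairs `(u, u′)`, `(v, v′)` of
`(p g′)′ = (q − z) g` (`p = λ² − x²`, `q = (2πλx)²`) with constant Wronskian
`u (p v′) − v (p u′) ≡ ω ≠ 0`, and a locally integrable right-hand side `F`, the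
VARIATION-OF-PARAMETERS function

  `h(x) = −ω⁻¹ ( v(x) (α + ∫_{x₀}^x u F) + u(x) (β − ∫_{x₀}^x v F) )`

is `C¹` on `J` with derivative `k(x) = −ω⁻¹ ( v′(x) (α + ∫_{x₀}^x u F) + u′(x) (β − ∫_{x₀}^x v F) )`
(`hasDerivAt_greenFormula`, the `F`-terms cancel), and `p k` is a primitive of `(q − z) h − F`
(`pCoeff_mul_greenDeriv_sub`): `(p h′)′ = (q − z) h − F` in the FTC form used by the tree's Green
identity `intervalIntegral_green_of_primitive` — i.e. `(W − z) h = F` classically on `J`.  Both are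
two applications of "integration by parts against a primitive" (`intervalIntegral_mul_eq_of_primitive`,
rh-crit-cc-t14).  `greenFormula_intervalIntegral_eq` then records Green's identity
`∫_x^y ((Wθ) h − θ (z h + F)) = [θ (p k) − p θ′ h]_x^y` for `θ ∈ C²`.

0 `def`s, 0 named facts, no `sorry`; the functions `h`, `k` and the primitives are ARGUMENTS
characterised by hypotheses (`hU`, `hV`, `hh`, `hk`), so that consumers instantiate them freely.

## References
* [ConnesMoscovici2022] A. Connes, H. Moscovici, *The UV prolate spectrum matches the zeros of zeta*,
  PNAS 119 (2022) = arXiv:2112.05500, §1 eqs. (1.2), (1.5)–(1.6), Thm 1.6 (held text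
  `paper-arxiv-2112.05500`, chunks p0004–p0006).
* [ReedSimonIV1978] M. Reed, B. Simon, *Methods of Modern Mathematical Physics IV* (1978), §XIII.14.
-/

noncomputable section

open Complex Set MeasureTheory Filter intervalIntegral
open scoped Real Topology

namespace Literature.NumberTheory.ConnesMoscovici2022

variable {lam : ℝ} {z : ℂ}

section VariationOfParameters

variable {J : Set ℝ} {u u' v v' F U V h k : ℝ → ℂ} {ω α β : ℂ} {x₀ : ℝ}

/-- Continuity of a solution pair's members on the carrier. [folklore] -/
private theorem continuousOn_of_hasDerivAt {g g' : ℝ → ℂ} (hg : ∀ x ∈ J, HasDerivAt g (g' x) x) :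
    ContinuousOn g J := fun x hx ↦ (hg x hx).continuousAt.continuousWithinAt

/-- Continuity of `g′` for a solution pair (from continuity of `p g′` and `p ≠ 0`). [folklore] -/
private theorem continuousOn_deriv_of_sol (hJ : J ⊆ {x : ℝ | x ≠ lam ∧ x ≠ -lam}) {g g' : ℝ → ℂ}
    (hu : ∀ x ∈ J, HasDerivAt (fun y ↦ pCoeff lam y * g' y) ((qCoeff lam x - z) * g x) x) :
    ContinuousOn g' J := by
  have hp0 : ∀ t ∈ J, pCoeff lam t ≠ 0 := fun t ht ↦ pCoeff_ne_zero_iff.2 (hJ ht)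
  have hpc : ContinuousOn (fun t ↦ pCoeff lam t * g' t) J := fun x hx ↦
    (hu x hx).continuousAt.continuousWithinAt
  have h := hpc.div (continuous_pCoeff_def lam).continuousOn hp0
  refine h.congr fun t ht ↦ ?_
  simp only [Pi.div_apply]
  rw [mul_div_cancel_left₀ _ (hp0 t ht)]

/-- Continuity of a primitive `b ↦ ∫_a^b f` on `[[s₁, s₂]]` when `f` is interval integrable between
any two points of an order-connected set containing `a, s₁, s₂`. [folklore] -/
private theorem continuousOn_primitive_of_mem {f : ℝ → ℂ}
    (hf : ∀ x ∈ J, ∀ y ∈ J, IntervalIntegrable f volume x y) {a s₁ s₂ : ℝ} (ha : a ∈ J)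
    (h₁ : s₁ ∈ J) (h₂ : s₂ ∈ J) :
    ContinuousOn (fun b ↦ ∫ t in a..b, f t) (uIcc s₁ s₂) := by
  have hlo : min a (min s₁ s₂) ∈ J := by
    simp only [min_def]; split_ifs <;> assumption
  have hhi : max a (max s₁ s₂) ∈ J := by
    simp only [max_def]; split_ifs <;> assumption
  have hle : min a (min s₁ s₂) ≤ max a (max s₁ s₂) := le_trans (min_le_left _ _) (le_max_left _ _)
  have hmem : ∀ t, min a (min s₁ s₂) ≤ t → t ≤ max a (max s₁ s₂) →
      t ∈ uIcc (min a (min s₁ s₂)) (max a (max s₁ s₂)) := fun t h1 h2 ↦ by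
    rw [uIcc_of_le hle]; exact ⟨h1, h2⟩
  have hc := intervalIntegral.continuousOn_primitive_interval' (hf _ hlo _ hhi)
    (a := a) (hmem a (min_le_left _ _) (le_max_left _ _))
  refine hc.mono (uIcc_subset_uIcc ?_ ?_)
  · exact hmem s₁ (le_trans (min_le_right _ _) (min_le_left _ _))
      (le_trans (le_max_left _ _) (le_max_right _ _))
  · exact hmem s₂ (le_trans (min_le_right _ _) (min_le_right _ _))
      (le_trans (le_max_right _ _) (le_max_right _ _))

/-- **Variation of parameters, first derivative.**  With the primitives `U(x) = ∫_{x₀}^x u F`,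
`V(x) = ∫_{x₀}^x v F` (locally integrable `F`), the function
`h = −ω⁻¹ (v (α + U) + u (β − V))` satisfies `h(y) − h(x) = ∫_x^y k`,
`k = −ω⁻¹ (v′ (α + U) + u′ (β − V))` — the `F`-terms cancel.
[cite: ConnesMoscovici2022, §1 eqs. (1.5)–(1.6) (= arXiv:2112.05500 (2.5)–(2.6), chunk p0005:L24–L31); Thm 1.6 (iv)] -/
theorem greenFormula_sub_eq_integral (hJ : J ⊆ {x : ℝ | x ≠ lam ∧ x ≠ -lam}) (hJc : OrdConnected J)
    (hu : ∀ x ∈ J, HasDerivAt u (u' x) x)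
    (huu : ∀ x ∈ J, HasDerivAt (fun y ↦ pCoeff lam y * u' y) ((qCoeff lam x - z) * u x) x)
    (hv : ∀ x ∈ J, HasDerivAt v (v' x) x)
    (hvu : ∀ x ∈ J, HasDerivAt (fun y ↦ pCoeff lam y * v' y) ((qCoeff lam x - z) * v x) x)
    (hF : ∀ x ∈ J, ∀ y ∈ J, IntervalIntegrable F volume x y) (hx₀ : x₀ ∈ J)
    (hU : ∀ x, U x = ∫ t in x₀..x, u t * F t) (hV : ∀ x, V x = ∫ t in x₀..x, v t * F t)
    (hh : ∀ x, h x = -(v x * (α + U x) + u x * (β - V x)) / ω)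
    (hk : ∀ x, k x = -(v' x * (α + U x) + u' x * (β - V x)) / ω)
    {x y : ℝ} (hx : x ∈ J) (hy : y ∈ J) (hxy : x ≤ y) :
    h y - h x = ∫ t in x..y, k t := by
  have hI : Icc x y ⊆ J := hJc.out hx hy
  have hIu : uIcc x y ⊆ J := by rwa [uIcc_of_le hxy]
  have huc : ContinuousOn u J := continuousOn_of_hasDerivAt hu
  have hvc : ContinuousOn v J := continuousOn_of_hasDerivAt hv
  have hu'c : ContinuousOn u' J := continuousOn_deriv_of_sol hJ huu
  have hv'c : ContinuousOn v' J := continuousOn_deriv_of_sol hJ hvu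
  -- integrability of `u F`, `v F` between points of `J`
  have hiuF : ∀ a ∈ J, ∀ b ∈ J, IntervalIntegrable (fun t ↦ u t * F t) volume a b := fun a ha b hb ↦
    (hF a ha b hb).continuousOn_mul (huc.mono (hJc.uIcc_subset ha hb))
  have hivF : ∀ a ∈ J, ∀ b ∈ J, IntervalIntegrable (fun t ↦ v t * F t) volume a b := fun a ha b hb ↦
    (hF a ha b hb).continuousOn_mul (hvc.mono (hJc.uIcc_subset ha hb))
  -- the primitives restarted at `x`
  have hU' : ∀ s ∈ Icc x y, (α + U s) = (α + U x) + ∫ t in x..s, u t * F t := by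
    intro s hs
    rw [hU, hU, ← integral_interval_sub_left (hiuF _ hx₀ _ (hI hs)) (hiuF _ hx₀ _ hx)]
    ring
  have hV' : ∀ s ∈ Icc x y, (β - V s) = (β - V x) + ∫ t in x..s, -(v t * F t) := by
    intro s hs
    rw [hV, hV, intervalIntegral.integral_neg,
      ← integral_interval_sub_left (hivF _ hx₀ _ (hI hs)) (hivF _ hx₀ _ hx)]
    ring
  -- two integrations by parts against primitives
  have h1 := intervalIntegral_mul_eq_of_primitive hxy (hiuF x hx y hy) hU'
    (fun s hs ↦ hv s (hI hs)) (hv'c.mono hI)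
  have hivFn : IntervalIntegrable (fun t ↦ -(v t * F t)) volume x y := (hivF x hx y hy).neg
  have h2 := intervalIntegral_mul_eq_of_primitive hxy hivFn hV'
    (fun s hs ↦ hu s (hI hs)) (hu'c.mono hI)
  -- `∫ (v (uF) + u (−vF)) = 0`
  have hsum : (∫ t in x..y, v t * (u t * F t)) + ∫ t in x..y, u t * -(v t * F t) = 0 := by
    rw [← intervalIntegral.integral_add ((hiuF x hx y hy).continuousOn_mul (hvc.mono hIu))
      (hivFn.continuousOn_mul (huc.mono hIu))]
    rw [intervalIntegral.integral_congr (g := fun _ ↦ (0 : ℂ)) (fun t _ ↦ by ring)]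
    simp
  -- continuity of the primitives on `[x, y]`
  have hUc : ContinuousOn U (Icc x y) := by
    have := continuousOn_primitive_of_mem hiuF hx₀ hx hy
    rw [uIcc_of_le hxy] at this
    exact this.congr fun s _ ↦ hU s
  have hVc : ContinuousOn V (Icc x y) := by
    have := continuousOn_primitive_of_mem hivF hx₀ hx hy
    rw [uIcc_of_le hxy] at this
    exact this.congr fun s _ ↦ hV s
  have hik1 : IntervalIntegrable (fun s ↦ v' s * (α + U s)) volume x y := by
    refine ContinuousOn.intervalIntegrable ?_
    rw [uIcc_of_le hxy]
    exact (hv'c.mono hI).mul (continuousOn_const.add hUc)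
  have hik2 : IntervalIntegrable (fun s ↦ u' s * (β - V s)) volume x y := by
    refine ContinuousOn.intervalIntegrable ?_
    rw [uIcc_of_le hxy]
    exact (hu'c.mono hI).mul (continuousOn_const.sub hVc)
  -- assemble
  have hk' : ∫ t in x..y, k t = -(∫ t in x..y, (v' t * (α + U t) + u' t * (β - V t))) / ω := by
    rw [← intervalIntegral.integral_neg, ← intervalIntegral.integral_div]
    exact intervalIntegral.integral_congr fun t _ ↦ by rw [hk]
  rw [hk', intervalIntegral.integral_add hik1 hik2, hh, hh]
  linear_combination (h1 + h2 - hsum) / ω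

/-- **Variation of parameters: `h` is differentiable on `J` with derivative `k`** (`J` open).
[cite: ConnesMoscovici2022, §1 eqs. (1.5)–(1.6) (= arXiv:2112.05500 (2.5)–(2.6), chunk p0005:L24–L31); Thm 1.6 (iv)] -/
theorem hasDerivAt_greenFormula (hJ : J ⊆ {x : ℝ | x ≠ lam ∧ x ≠ -lam}) (hJo : IsOpen J)
    (hJc : OrdConnected J)
    (hu : ∀ x ∈ J, HasDerivAt u (u' x) x)
    (huu : ∀ x ∈ J, HasDerivAt (fun y ↦ pCoeff lam y * u' y) ((qCoeff lam x - z) * u x) x)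
    (hv : ∀ x ∈ J, HasDerivAt v (v' x) x)
    (hvu : ∀ x ∈ J, HasDerivAt (fun y ↦ pCoeff lam y * v' y) ((qCoeff lam x - z) * v x) x)
    (hF : ∀ x ∈ J, ∀ y ∈ J, IntervalIntegrable F volume x y) (hx₀ : x₀ ∈ J)
    (hU : ∀ x, U x = ∫ t in x₀..x, u t * F t) (hV : ∀ x, V x = ∫ t in x₀..x, v t * F t)
    (hh : ∀ x, h x = -(v x * (α + U x) + u x * (β - V x)) / ω)
    (hk : ∀ x, k x = -(v' x * (α + U x) + u' x * (β - V x)) / ω) :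
    ContinuousOn k J ∧ ∀ x ∈ J, HasDerivAt h (k x) x := by
  have huc : ContinuousOn u J := continuousOn_of_hasDerivAt hu
  have hvc : ContinuousOn v J := continuousOn_of_hasDerivAt hv
  have hu'c : ContinuousOn u' J := continuousOn_deriv_of_sol hJ huu
  have hv'c : ContinuousOn v' J := continuousOn_deriv_of_sol hJ hvu
  have hiuF : ∀ a ∈ J, ∀ b ∈ J, IntervalIntegrable (fun t ↦ u t * F t) volume a b := fun a ha b hb ↦
    (hF a ha b hb).continuousOn_mul (huc.mono (hJc.uIcc_subset ha hb))
  have hivF : ∀ a ∈ J, ∀ b ∈ J, IntervalIntegrable (fun t ↦ v t * F t) volume a b := fun a ha b hb ↦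
    (hF a ha b hb).continuousOn_mul (hvc.mono (hJc.uIcc_subset ha hb))
  -- continuity of `U`, `V` on `J`
  have hUc : ContinuousOn U J := by
    intro s hs
    -- continuity within `J` at `s`: use an interval neighbourhood inside `J`
    obtain ⟨ε, hε, hball⟩ := Metric.isOpen_iff.1 hJo s hs
    have h1 : s - ε / 2 ∈ J := hball (Metric.mem_ball.2 (by rw [Real.dist_eq, abs_lt]; constructor <;> linarith))
    have h2 : s + ε / 2 ∈ J := hball (Metric.mem_ball.2 (by rw [Real.dist_eq, abs_lt]; constructor <;> linarith))
    have hc2 := continuousOn_primitive_of_mem hiuF hx₀ h1 h2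
    rw [uIcc_of_le (by linarith)] at hc2
    have hcs : ContinuousAt (fun b ↦ ∫ t in x₀..b, u t * F t) s :=
      hc2.continuousAt (Icc_mem_nhds (by linarith) (by linarith))
    exact (hcs.congr (Eventually.of_forall fun b ↦ (hU b).symm)).continuousWithinAt
  have hVc : ContinuousOn V J := by
    intro s hs
    obtain ⟨ε, hε, hball⟩ := Metric.isOpen_iff.1 hJo s hs
    have h1 : s - ε / 2 ∈ J := hball (Metric.mem_ball.2 (by rw [Real.dist_eq, abs_lt]; constructor <;> linarith))
    have h2 : s + ε / 2 ∈ J := hball (Metric.mem_ball.2 (by rw [Real.dist_eq, abs_lt]; constructor <;> linarith))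
    have hc2 := continuousOn_primitive_of_mem hivF hx₀ h1 h2
    rw [uIcc_of_le (by linarith)] at hc2
    have hcs : ContinuousAt (fun b ↦ ∫ t in x₀..b, v t * F t) s :=
      hc2.continuousAt (Icc_mem_nhds (by linarith) (by linarith))
    exact (hcs.congr (Eventually.of_forall fun b ↦ (hV b).symm)).continuousWithinAt
  have hkc : ContinuousOn k J := by
    have : ContinuousOn (fun x ↦ -(v' x * (α + U x) + u' x * (β - V x)) / ω) J :=
      ((hv'c.mul (continuousOn_const.add hUc)).add (hu'c.mul (continuousOn_const.sub hVc))).neg.div_const _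
    exact this.congr fun x _ ↦ hk x
  refine ⟨hkc, fun x hx ↦ ?_⟩
  -- an interval neighbourhood `[x₁, y₁] ⊆ J` of `x`
  obtain ⟨ε, hε, hball⟩ := Metric.isOpen_iff.1 hJo x hx
  have h1 : x - ε / 2 ∈ J := hball (Metric.mem_ball.2 (by rw [Real.dist_eq, abs_lt]; constructor <;> linarith))
  have h2 : x + ε / 2 ∈ J := hball (Metric.mem_ball.2 (by rw [Real.dist_eq, abs_lt]; constructor <;> linarith))
  have hIcc : Icc (x - ε / 2) (x + ε / 2) ⊆ J := hJc.out h1 h2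
  -- on this neighbourhood `h s = h x₁ + ∫_{x₁}^s k`
  have hrep : ∀ s ∈ Icc (x - ε / 2) (x + ε / 2), h s = h (x - ε / 2) + ∫ t in (x - ε / 2)..s, k t := by
    intro s hs
    have := greenFormula_sub_eq_integral hJ hJc hu huu hv hvu hF hx₀ hU hV hh hk h1 (hIcc hs) hs.1
    linear_combination this
  have hki : IntervalIntegrable k volume (x - ε / 2) (x + ε / 2) :=
    (hkc.mono (by rw [uIcc_of_le (by linarith)]; exact hIcc)).intervalIntegrable
  have hkx : ContinuousAt k x := hkc.continuousAt (hJo.mem_nhds hx)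
  have hD : HasDerivAt (fun s ↦ ∫ t in (x - ε / 2)..s, k t) (k x) x :=
    intervalIntegral.integral_hasDerivAt_right (hki.mono_set (by
      rw [uIcc_of_le (by linarith), uIcc_of_le (by linarith)]
      exact Icc_subset_Icc_right (by linarith)))
      (hkc.stronglyMeasurableAtFilter hJo _ hx) hkx
  have hD' : HasDerivAt (fun s ↦ h (x - ε / 2) + ∫ t in (x - ε / 2)..s, k t) (k x) x := by
    simpa using hD.const_add (h (x - ε / 2))
  refine hD'.congr_of_eventuallyEq ?_
  filter_upwards [Icc_mem_nhds (by linarith : x - ε / 2 < x) (by linarith : x < x + ε / 2)] with s hs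
  exact hrep s hs

/-- **Variation of parameters, second derivative in FTC form**: `p k` is a primitive of
`(q − z) h − F` on `J`, i.e. `(p h′)′ = (q − z) h − F`, i.e. `(W − z) h = F` classically.
[cite: ConnesMoscovici2022, §1 eqs. (1.2), (1.5)–(1.6) (= arXiv:2112.05500 (2.2), (2.5)–(2.6), chunks p0004:L16–L22, p0005:L24–L31); Thm 1.6 (iv)] -/
theorem pCoeff_mul_greenDeriv_sub (hJc : OrdConnected J)
    (hu : ∀ x ∈ J, HasDerivAt u (u' x) x)
    (huu : ∀ x ∈ J, HasDerivAt (fun y ↦ pCoeff lam y * u' y) ((qCoeff lam x - z) * u x) x)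
    (hv : ∀ x ∈ J, HasDerivAt v (v' x) x)
    (hvu : ∀ x ∈ J, HasDerivAt (fun y ↦ pCoeff lam y * v' y) ((qCoeff lam x - z) * v x) x)
    (hW : ∀ x ∈ J, u x * (pCoeff lam x * v' x) - v x * (pCoeff lam x * u' x) = ω) (hω : ω ≠ 0)
    (hF : ∀ x ∈ J, ∀ y ∈ J, IntervalIntegrable F volume x y) (hx₀ : x₀ ∈ J)
    (hU : ∀ x, U x = ∫ t in x₀..x, u t * F t) (hV : ∀ x, V x = ∫ t in x₀..x, v t * F t)
    (hh : ∀ x, h x = -(v x * (α + U x) + u x * (β - V x)) / ω)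
    (hk : ∀ x, k x = -(v' x * (α + U x) + u' x * (β - V x)) / ω)
    {x y : ℝ} (hx : x ∈ J) (hy : y ∈ J) (hxy : x ≤ y) :
    pCoeff lam y * k y - pCoeff lam x * k x = ∫ t in x..y, ((qCoeff lam t - z) * h t - F t) := by
  have hI : Icc x y ⊆ J := hJc.out hx hy
  have hIu : uIcc x y ⊆ J := by rwa [uIcc_of_le hxy]
  have huc : ContinuousOn u J := continuousOn_of_hasDerivAt hu
  have hvc : ContinuousOn v J := continuousOn_of_hasDerivAt hv
  have hqc : Continuous fun t ↦ qCoeff lam t - z := (continuous_qCoeff_def lam).sub continuous_const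
  have hiuF : ∀ a ∈ J, ∀ b ∈ J, IntervalIntegrable (fun t ↦ u t * F t) volume a b := fun a ha b hb ↦
    (hF a ha b hb).continuousOn_mul (huc.mono (hJc.uIcc_subset ha hb))
  have hivF : ∀ a ∈ J, ∀ b ∈ J, IntervalIntegrable (fun t ↦ v t * F t) volume a b := fun a ha b hb ↦
    (hF a ha b hb).continuousOn_mul (hvc.mono (hJc.uIcc_subset ha hb))
  have hU' : ∀ s ∈ Icc x y, (α + U s) = (α + U x) + ∫ t in x..s, u t * F t := by
    intro s hs
    rw [hU, hU, ← integral_interval_sub_left (hiuF _ hx₀ _ (hI hs)) (hiuF _ hx₀ _ hx)]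
    ring
  have hV' : ∀ s ∈ Icc x y, (β - V s) = (β - V x) + ∫ t in x..s, -(v t * F t) := by
    intro s hs
    rw [hV, hV, intervalIntegral.integral_neg,
      ← integral_interval_sub_left (hivF _ hx₀ _ (hI hs)) (hivF _ hx₀ _ hx)]
    ring
  -- IBP against the primitives, with `φ = p v′` and `φ = p u′`
  have h1 := intervalIntegral_mul_eq_of_primitive hxy (hiuF x hx y hy) hU'
    (fun s hs ↦ hvu s (hI hs)) ((hqc.continuousOn.mul (hvc.mono hI)))
  have hivFn : IntervalIntegrable (fun t ↦ -(v t * F t)) volume x y := (hivF x hx y hy).neg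
  have h2 := intervalIntegral_mul_eq_of_primitive hxy hivFn hV'
    (fun s hs ↦ huu s (hI hs)) ((hqc.continuousOn.mul (huc.mono hI)))
  -- continuity of the primitives on `[x, y]`
  have hUc : ContinuousOn U (Icc x y) := by
    have := continuousOn_primitive_of_mem hiuF hx₀ hx hy
    rw [uIcc_of_le hxy] at this
    exact this.congr fun s _ ↦ hU s
  have hVc : ContinuousOn V (Icc x y) := by
    have := continuousOn_primitive_of_mem hivF hx₀ hx hy
    rw [uIcc_of_le hxy] at this
    exact this.congr fun s _ ↦ hV s
  have hpv'c : ContinuousOn (fun t ↦ pCoeff lam t * v' t) (Icc x y) := fun t ht ↦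
    (hvu t (hI ht)).continuousAt.continuousWithinAt
  have hpu'c : ContinuousOn (fun t ↦ pCoeff lam t * u' t) (Icc x y) := fun t ht ↦
    (huu t (hI ht)).continuousAt.continuousWithinAt
  -- the pieces of the right-hand side
  have hiA : IntervalIntegrable (fun t ↦ (pCoeff lam t * v' t) * (u t * F t)) volume x y :=
    (hiuF x hx y hy).continuousOn_mul (by rw [uIcc_of_le hxy]; exact hpv'c)
  have hiB : IntervalIntegrable (fun t ↦ (pCoeff lam t * u' t) * -(v t * F t)) volume x y :=
    hivFn.continuousOn_mul (by rw [uIcc_of_le hxy]; exact hpu'c)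
  have hiC : IntervalIntegrable (fun s ↦ (qCoeff lam s - z) * v s * (α + U s)) volume x y := by
    refine ContinuousOn.intervalIntegrable ?_
    rw [uIcc_of_le hxy]
    exact (hqc.continuousOn.mul (hvc.mono hI)).mul (continuousOn_const.add hUc)
  have hiD : IntervalIntegrable (fun s ↦ (qCoeff lam s - z) * u s * (β - V s)) volume x y := by
    refine ContinuousOn.intervalIntegrable ?_
    rw [uIcc_of_le hxy]
    exact (hqc.continuousOn.mul (huc.mono hI)).mul (continuousOn_const.sub hVc)
  have hiF : IntervalIntegrable F volume x y := hF x hx y hy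
  have hih : IntervalIntegrable (fun t ↦ (qCoeff lam t - z) * h t) volume x y := by
    have : IntervalIntegrable (fun t ↦ -((qCoeff lam t - z) * v t * (α + U t) +
        (qCoeff lam t - z) * u t * (β - V t)) / ω) volume x y := (hiC.add hiD).neg.div_const _
    refine this.congr fun t _ ↦ ?_
    simp only [hh]; ring
  -- Wronskian: `(p v′) u F − (p u′) v F = ω F`
  have hAB : (∫ t in x..y, (pCoeff lam t * v' t) * (u t * F t)) +
      ∫ t in x..y, (pCoeff lam t * u' t) * -(v t * F t) = ω * ∫ t in x..y, F t := by
    rw [← intervalIntegral.integral_add hiA hiB, ← intervalIntegral.integral_const_mul]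
    refine intervalIntegral.integral_congr fun t ht ↦ ?_
    have hW' := hW t (hIu ht)
    rw [← hW']; ring
  -- `(q − z)(v (α+U) + u (β − V)) = −ω (q − z) h`
  have hCD : (∫ s in x..y, (qCoeff lam s - z) * v s * (α + U s)) +
      ∫ s in x..y, (qCoeff lam s - z) * u s * (β - V s) = -ω * ∫ t in x..y, (qCoeff lam t - z) * h t := by
    rw [← intervalIntegral.integral_add hiC hiD, ← intervalIntegral.integral_const_mul]
    refine intervalIntegral.integral_congr fun t _ ↦ ?_
    rw [hh]
    field_simp
  rw [intervalIntegral.integral_sub hih hiF, hk, hk]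
  have hc1 : ω * ω⁻¹ = 1 := mul_inv_cancel₀ hω
  linear_combination (h1 + h2 - hAB - hCD) / ω +
    ((∫ t in x..y, (qCoeff lam t - z) * h t) - ∫ t in x..y, F t) * hc1

/-- **Green's identity for the variation-of-parameters function.**  For `θ ∈ C²(ℝ)` and
`[x, y] ⊆ J`:  `∫_x^y ((Wθ) h − θ (z h + F)) = [θ (p h′) − p θ′ h]_x^y`, `Wθ = −(pθ′)′ + qθ`
(the tree's `intervalIntegral_green_of_primitive` fed with `(p h′)′ = (q − z) h − F`).
[cite: ConnesMoscovici2022, §1 eqs. (1.2), (1.5)–(1.6) (= arXiv:2112.05500 (2.2), (2.5)–(2.6), chunks p0004:L16–L22, p0005:L24–L31); Thm 1.6 (iv)] -/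
theorem greenFormula_intervalIntegral_eq (hJ : J ⊆ {x : ℝ | x ≠ lam ∧ x ≠ -lam}) (hJo : IsOpen J)
    (hJc : OrdConnected J)
    (hu : ∀ x ∈ J, HasDerivAt u (u' x) x)
    (huu : ∀ x ∈ J, HasDerivAt (fun y ↦ pCoeff lam y * u' y) ((qCoeff lam x - z) * u x) x)
    (hv : ∀ x ∈ J, HasDerivAt v (v' x) x)
    (hvu : ∀ x ∈ J, HasDerivAt (fun y ↦ pCoeff lam y * v' y) ((qCoeff lam x - z) * v x) x)
    (hW : ∀ x ∈ J, u x * (pCoeff lam x * v' x) - v x * (pCoeff lam x * u' x) = ω) (hω : ω ≠ 0)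
    (hF : ∀ x ∈ J, ∀ y ∈ J, IntervalIntegrable F volume x y) (hx₀ : x₀ ∈ J)
    (hU : ∀ x, U x = ∫ t in x₀..x, u t * F t) (hV : ∀ x, V x = ∫ t in x₀..x, v t * F t)
    (hh : ∀ x, h x = -(v x * (α + U x) + u x * (β - V x)) / ω)
    (hk : ∀ x, k x = -(v' x * (α + U x) + u' x * (β - V x)) / ω)
    {θ : ℝ → ℂ} (hθ : ContDiff ℝ 2 θ) {x y : ℝ} (hx : x ∈ J) (hy : y ∈ J) (hxy : x ≤ y) :
    ∫ t in x..y, ((-deriv (fun s ↦ pCoeff lam s * deriv θ s) t + qCoeff lam t * θ t) * h t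
        - θ t * (z * h t + F t)) =
      (θ y * (pCoeff lam y * k y) - pCoeff lam y * deriv θ y * h y) -
        (θ x * (pCoeff lam x * k x) - pCoeff lam x * deriv θ x * h x) := by
  have hI : Icc x y ⊆ J := hJc.out hx hy
  obtain ⟨hkc, hd⟩ := hasDerivAt_greenFormula hJ hJo hJc hu huu hv hvu hF hx₀ hU hV hh hk
  have hderiv : ∀ s ∈ J, deriv h s = k s := fun s hs ↦ (hd s hs).deriv
  have hg : ∀ s ∈ Icc x y, HasDerivAt h (deriv h s) s := fun s hs ↦ by
    rw [hderiv s (hI hs)]; exact hd s (hI hs)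
  have hg' : ContinuousOn (deriv h) (Icc x y) :=
    (hkc.mono hI).congr fun s hs ↦ hderiv s (hI hs)
  have hhc : ContinuousOn h (Icc x y) := fun s hs ↦ (hd s (hI hs)).continuousAt.continuousWithinAt
  have hf : IntervalIntegrable (fun t ↦ (qCoeff lam t - z) * h t - F t) volume x y := by
    refine IntervalIntegrable.sub ?_ (hF x hx y hy)
    refine ContinuousOn.intervalIntegrable ?_
    rw [uIcc_of_le hxy]
    exact (((continuous_qCoeff_def lam).sub continuous_const).continuousOn).mul hhc
  have hFTC : ∀ s ∈ Icc x y, pCoeff lam s * k s =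
      pCoeff lam x * k x + ∫ t in x..s, ((qCoeff lam t - z) * h t - F t) := by
    intro s hs
    have := pCoeff_mul_greenDeriv_sub hJc hu huu hv hvu hW hω hF hx₀ hU hV hh hk hx (hI hs) hs.1
    linear_combination this
  have hG := intervalIntegral_green_of_primitive lam hxy hθ hg hg'
    (u := fun s ↦ pCoeff lam s * k s) (fun s hs ↦ by simp only [hderiv s (hI hs)]) hFTC hf
  rw [← hG]
  refine intervalIntegral.integral_congr fun t _ ↦ ?_
  ring

end VariationOfParameters


end Literature.NumberTheory.ConnesMoscovici2022

end
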